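import Summits.HodgeConjecture.HodgeConjecture.Theorems.MarkmanPartnerTransportLatticeBridgeSpan
import Summits.HodgeConjecture.HodgeConjecture.Theorems.MarkmanPartnerTransportPartnerExistenceLatticeHodgeIndex
import Literature.AlgebraicGeometry.HodgeTheory.LefschetzOneOneHolds
import Literature.AlgebraicGeometry.HodgeTheory.AlgebraicClassesHodgeTypeHolds

/-!
# Route MarkmanPartnerTransport · crux #5 `LowPicardRealMultiplication` — the period datum of a marked
# `K3^{[2]}`-type fourfold, and the reading of its rational Hodge endomorphisms in `End_Hdg(T(X)_ℚ)`

`X`-side instance of the generic lattice bridge (`…LatticeBridge{Complexification,Hodge,Span}`): for a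
smooth projective fourfold `X` marked as in the route declarations (`MarkedK3Sq[X, φ, P, z]`, clauses
(m1)–(m6): integral marking `φ : H²(X(ℂ); ℂ) ≅ ℂ²³`, polarised Fujiki relation, the period `z` spanning
`H^{2,0}`, `(1,1) ⟺ ⊥ z, z̄`, `q(z,z) = 0`, `Re q(z̄,z) > 0`) and the rational Néron–Severi space
`N_ℚ = φ(N¹(X)) ∩ ℚ²³` (`exists_ratNeronSeveri`, prover g5), the data `(q_ℚ, q_ℂ, N_ℚ, T_ℚ = N_ℚ^⊥, z)`
form a `PeriodDatum` (`periodDatum`): compatibility and reality of the BBF form, `ℚ²³ = N_ℚ ⊕ T_ℚ`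
(`isCompl_ratNeronSeveri_orthogonal`), `N_ℚ` = the rational `(1,1)`-vectors (Lefschetz `(1,1)`, a tree
theorem), `z ∈ T_ℚ ⊗ ℂ` (`period_mem_span_ratTransc`), and the Hodge index on `T_ℂ ∩ {z, z̄}^⊥` (from
g5's `k3HilbertForm_self_neg_of_oneOne_of_kaehler_orthogonal`, via real and imaginary parts). Hence
`T(X)_ℚ` carries an irreducible polarized Hodge structure of K3 type on the tree's abstract carriers, to
which Zarhin's and van Geemen's theorems apply; and every rational, type-preserving endomorphism of
`H²(X(ℂ); ℂ)` is, in coordinates, the complexification of a rational endomorphism with the period as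
eigenvector preserving `{z, z̄}^⊥` (`exists_ratEnd_of_hodgeEndomorphism`). Consumer: `…K3Sq2OneCycle`.
No named-fact hypothesis, no sorry; one definition (`periodDatum`). Prover seat hodge-nonav-19652-p1
(gen 8), `--supports stmt-HodgeConjecture-19653`.

References: D. Huybrechts, *Lectures on K3 Surfaces*, Ch. 3 Lemma 3.1, §3.3.5; A. Beauville, J. Differential
Geom. 18 (1983) §8 Thm. 5; C. Voisin, *Hodge Theory I*, §6.3.2 Thm. 6.32, §7.1.1.
-/

noncomputable section

set_option linter.dupNamespace false

open scoped TensorProduct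
open Module CategoryTheory
open Literature.AlgebraicTopology.SingularHomology Literature.Geometry.Kaehler
open Literature.AlgebraicGeometry Literature.AlgebraicGeometry.Motives Literature.AlgebraicGeometry.HodgeTheory
open Literature.AlgebraicGeometry.Hyperkaehler Literature.AlgebraicGeometry.Surfaces
open Summit.HodgeConjecture.HodgeConjecture.Theorems.NikulinTwinTransport
open Summit.HodgeConjecture.HodgeConjecture.Theorems.MarkmanPartnerTransport.BBFPositivity
open Summit.HodgeConjecture.HodgeConjecture.Theorems.MarkmanPartnerTransport.LatticeBridge

namespace Summit.HodgeConjecture.HodgeConjecture.Theorems.MarkmanPartnerTransport.PartnerLattice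

/-- `MarkedK3Sq[X, φ, P, z]`: VERBATIM the `let MarkedK3Sq := …` binder of the route declarations of
MarkmanPartnerTransport (clauses (m1)–(m6)). Local notation only. -/
local notation3 (prettyPrint := false) "MarkedK3Sq[" X ", " φ ", " P ", " z "]" =>
  (((IsIntegralClass P ∧ ∀ Q : complexBetti X (2 * 4), IsIntegralClass Q → ∃ n : ℤ, Q = n • P) ∧
    (∀ c : complexBetti X 2, IsIntegralClass c ↔ ∃ v : K3HilbertIndex → ℤ, φ c = fun i => (v i : ℂ)) ∧
    (∀ a : complexBetti X 2, cupPowTwo a 4 = ((3 : ℂ) * (k3HilbertForm 2 (φ a) (φ a)) ^ 2) • P) ∧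
    (IsOfHodgeType 4 X 2 2 0 (LinearEquiv.symm φ z) ∧
      ∀ τ : complexBetti X 2, IsOfHodgeType 4 X 2 2 0 τ → ∃ t : ℂ, τ = t • LinearEquiv.symm φ z) ∧
    (∀ c : complexBetti X 2, IsOfHodgeType 4 X 2 1 1 c ↔
      (k3HilbertForm 2 (φ c) z = 0 ∧ k3HilbertForm 2 (φ c) (star z) = 0)) ∧
    (k3HilbertForm 2 z z = 0 ∧ 0 < (k3HilbertForm 2 (star z) z).re)))

/-- `qQ`: the rational Beauville–Bogomolov form `q` on `ℚ²³` (Gram matrix `Λ₂₃`). -/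
local notation3 (prettyPrint := false) "qQ" => Matrix.toBilin' (Matrix.map (k3HilbertGram 2) (Int.cast : ℤ → ℚ))

/-- `qC`: the complex Beauville–Bogomolov form on `ℂ²³`. -/
local notation3 (prettyPrint := false) "qC" => Matrix.toBilin' (Matrix.map (k3HilbertGram 2) (Int.cast : ℤ → ℂ))

variable {X : SchemeOver ℂ} {φ : complexBetti X 2 ≃ₗ[ℂ] (K3HilbertIndex → ℂ)} {P : complexBetti X (2 * 4)}
  {z : K3HilbertIndex → ℂ} {NQ : Submodule ℚ (K3HilbertIndex → ℚ)}

/-! ### The Hodge index on `T_ℂ ∩ {z, z̄}^⊥` -/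

/-- **Hodge index on the complex transcendental space**: a non-zero `v ∈ T_ℚ ⊗ ℂ` with `q(v, z) = q(v, z̄) = 0`
has `Re q(v, v̄) < 0`. With `p = v + v̄`, `m = i(v − v̄)` (real, of type `(1,1)`, `q`-orthogonal to the
Kähler class of a Kähler–rational datum) one has `4 q(v, v̄) = q(p, p) + q(m, m)`, and g5's Hodge index
`k3HilbertForm_self_neg_of_oneOne_of_kaehler_orthogonal` gives `q(p,p), q(m,m) < 0` unless zero.
[cite: Beauville1983, §8 Thm. 5] [cite: VoisinHodgeI2002, §6.3.2 Thm. 6.32] -/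
theorem re_bbf_self_star_neg (hX : IsSmoothProjective 4 X) (hM : MarkedK3Sq[X, φ, P, z])
    (hNQ : ∀ v, v ∈ NQ ↔ φ.symm (fun i => (v i : ℂ)) ∈ algebraicClasses X 1) {v : K3HilbertIndex → ℂ}
    (hv : v ∈ Submodule.span ℂ (Set.range fun t : (qQ).orthogonal NQ =>
      fun i => (((t : K3HilbertIndex → ℚ) i : ℚ) : ℂ)))
    (hvz : k3HilbertForm 2 v z = 0) (hvz' : k3HilbertForm 2 v (star z) = 0) (hv0 : v ≠ 0) :
    (k3HilbertForm 2 v (star v)).re < 0 := by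
  obtain ⟨-, hint, -, -, h11, -⟩ := id hM
  obtain ⟨D⟩ := nonempty_kaehlerRationalDatum hX
  have hκN : D.Hη ∈ algebraicClasses X 1 :=
    lefschetzOneOne_rational_holds hX D.Hη D.isRationalClass_Hη D.isOfHodgeType_Hη
  -- `v ⊥ φ(N¹(X))`, in particular `v ⊥ φκ`; `φκ` is real
  have hv' : v ∈ Submodule.span ℂ ((fun a : K3HilbertIndex → ℚ => fun i => (a i : ℂ)) ''
      ((qQ).orthogonal NQ : Set (K3HilbertIndex → ℚ))) := by rwa [Set.image_eq_range]
  have hvκ : k3HilbertForm 2 v (φ D.Hη) = 0 := (mem_span_ratTransc_iff hX hint hNQ v).1 hv' _ hκN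
  obtain ⟨w, hw⟩ := (isRationalClass_iff_of_markedSq hX hint D.Hη).1 D.isRationalClass_Hη
  have hκreal : star (φ D.Hη) = φ D.Hη := by rw [hw, star_ratVec]
  have hsvκ : k3HilbertForm 2 (star v) (φ D.Hη) = 0 := by
    have h := congrArg star hvκ
    rwa [star_k3HilbertForm, hκreal, star_zero] at h
  -- conjugate orthogonality relations
  have hsvz : k3HilbertForm 2 (star v) z = 0 := by
    have h := congrArg star hvz'
    rwa [star_k3HilbertForm, star_star, star_zero] at h
  have hsvz' : k3HilbertForm 2 (star v) (star z) = 0 := by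
    have h := congrArg star hvz
    rwa [star_k3HilbertForm, star_zero] at h
  -- the real vectors `p = v + v̄`, `m = i (v - v̄)`
  set p : K3HilbertIndex → ℂ := v + star v with hp
  set m : K3HilbertIndex → ℂ := Complex.I • (v - star v) with hm
  clear_value p m
  have hpreal : star p = p := by rw [hp, star_add, star_star, add_comm]
  have hmreal : star m = m := by
    rw [hm, star_smul, star_sub, star_star, Complex.star_def, Complex.conj_I, neg_smul, ← smul_neg, neg_sub]
  have hsub : v - star v = v + (-1 : ℂ) • star v := by rw [neg_one_smul, sub_eq_add_neg]
  have hpz : k3HilbertForm 2 p z = 0 := by rw [hp, k3HilbertForm_add_left, hvz, hsvz, add_zero]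
  have hpz' : k3HilbertForm 2 p (star z) = 0 := by rw [hp, k3HilbertForm_add_left, hvz', hsvz', add_zero]
  have hmz : k3HilbertForm 2 m z = 0 := by
    rw [hm, k3HilbertForm_smul_left, hsub, k3HilbertForm_add_left, k3HilbertForm_smul_left, hvz, hsvz]; ring
  have hmz' : k3HilbertForm 2 m (star z) = 0 := by
    rw [hm, k3HilbertForm_smul_left, hsub, k3HilbertForm_add_left, k3HilbertForm_smul_left, hvz', hsvz']; ring
  have hpκ : k3HilbertForm 2 (φ D.Hη) p = 0 := by
    rw [k3HilbertForm_comm, hp, k3HilbertForm_add_left, hvκ, hsvκ, add_zero]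
  have hmκ : k3HilbertForm 2 (φ D.Hη) m = 0 := by
    rw [k3HilbertForm_comm, hm, k3HilbertForm_smul_left, hsub, k3HilbertForm_add_left, k3HilbertForm_smul_left, hvκ,
      hsvκ]; ring
  -- Hodge index for a real `(1,1)` vector orthogonal to `κ`: `Re q(u,u) ≤ 0`, `< 0` unless `u = 0`
  have key : ∀ u : K3HilbertIndex → ℂ, star u = u → k3HilbertForm 2 u z = 0 → k3HilbertForm 2 u (star z) = 0 →
      k3HilbertForm 2 (φ D.Hη) u = 0 →
      (k3HilbertForm 2 u u).re ≤ 0 ∧ (k3HilbertForm 2 u u).im = 0 ∧ (u ≠ 0 → (k3HilbertForm 2 u u).re < 0) := by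
    intro u hureal huz huz' huκ
    have him : (k3HilbertForm 2 u u).im = 0 := k3HilbertForm_im_eq_zero_of_star_eq hureal hureal
    by_cases hu0 : u = 0
    · subst hu0
      refine ⟨?_, him, fun h => absurd rfl h⟩
      rw [k3HilbertForm_eq_dotProduct]; simp
    set d : complexBetti X 2 := φ.symm u with hd
    have hφd : φ d = u := φ.apply_symm_apply u
    have hd11 : IsOfHodgeType 4 X 2 1 1 d := (h11 d).2 ⟨by rw [hφd]; exact huz, by rw [hφd]; exact huz'⟩
    have hdreal : conjClass (ComplexPoints X) 2 d = d := by
      apply φ.injective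
      rw [marking_conjClass hint, hφd, hureal]
    have hd0 : d ≠ 0 := fun h0 => hu0 (by rw [← hφd, h0, map_zero])
    have h := k3HilbertForm_self_neg_of_oneOne_of_kaehler_orthogonal hX hM D hd11 hdreal hd0 (by rw [hφd]; exact huκ)
    rw [hφd] at h
    exact ⟨h.1.le, him, fun _ => h.1⟩
  obtain ⟨hp_le, hp_im, hp_lt⟩ := key p hpreal hpz hpz' hpκ
  obtain ⟨hm_le, hm_im, hm_lt⟩ := key m hmreal hmz hmz' hmκ
  -- `4 q(v, v̄) = q(p,p) + q(m,m)`
  have hI : Complex.I * Complex.I = -1 := Complex.I_mul_I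
  have hvdec : v = (2 : ℂ)⁻¹ • (p - Complex.I • m) := by
    rw [hp, hm, smul_smul, hI, neg_one_smul, sub_neg_eq_add, add_add_sub_cancel, ← two_smul ℂ v, smul_smul]
    norm_num
  have hsvdec : star v = (2 : ℂ)⁻¹ • (p + Complex.I • m) := by
    rw [hp, hm, smul_smul, hI, neg_one_smul, ← sub_eq_add_neg, add_sub_sub_cancel, ← two_smul ℂ (star v), smul_smul]
    norm_num
  have hcomm : qC m p = qC p m := by rw [qC_apply, qC_apply, k3HilbertForm_comm]
  have hq : k3HilbertForm 2 v (star v) = (4 : ℂ)⁻¹ * (k3HilbertForm 2 p p + k3HilbertForm 2 m m) := by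
    rw [← qC_apply, ← qC_apply, ← qC_apply, hsvdec, hvdec]
    simp only [map_add, map_sub, map_smul, LinearMap.sub_apply, LinearMap.smul_apply, smul_eq_mul]
    rw [hcomm]
    linear_combination (-(4 : ℂ)⁻¹ * qC m m) * hI
  have hre : (k3HilbertForm 2 v (star v)).re = 4⁻¹ * ((k3HilbertForm 2 p p).re + (k3HilbertForm 2 m m).re) := by
    rw [hq, Complex.mul_re, Complex.add_re, Complex.add_im, hp_im, hm_im]
    norm_num
  rw [hre]
  -- at least one of `p`, `m` is non-zero
  by_cases hp0 : p = 0
  · have hm0 : m ≠ 0 := by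
      intro hm0
      apply hv0
      rw [hvdec, hp0, hm0, smul_zero, sub_zero, smul_zero]
    have := hm_lt hm0
    nlinarith
  · have := hp_lt hp0
    nlinarith

/-! ### The period datum of a marked `K3^{[2]}`-type fourfold -/

/-- **The period datum of a marked `K3^{[2]}`-type fourfold**: `(q_ℚ, q_ℂ, N_ℚ, T_ℚ = N_ℚ^⊥, z)` with
`N_ℚ = φ(N¹(X)) ∩ ℚ²³`. Its transcendental Hodge structure `(periodDatum …).hodgeT` is `T(X)_ℚ` with the
Hodge structure induced from `H²(X)` — irreducible of K3 type, polarized by `-q`.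
[cite: Huybrechts2016K3, Ch. 3 Lemma 3.1 and §3.3.5] [cite: Beauville1983, §8 Thm. 5] -/
def periodDatum (hX : IsSmoothProjective 4 X) (hM : MarkedK3Sq[X, φ, P, z])
    (hNQ : ∀ v, v ∈ NQ ↔ φ.symm (fun i => (v i : ℂ)) ∈ algebraicClasses X 1) : PeriodDatum K3HilbertIndex where
  B := qQ
  BC := qC
  N := NQ
  T := (qQ).orthogonal NQ
  x := z
  ratCast_form v w := by rw [qC_apply, k3HilbertForm_ratCast]
  B_comm := qQ_comm
  BC_comm a b := by rw [qC_apply, qC_apply, k3HilbertForm_comm]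
  BC_star a b := by rw [qC_apply, qC_apply, star_k3HilbertForm]
  nondegenerate := qQ_nondegenerate
  isCompl := isCompl_ratNeronSeveri_orthogonal hX hM hNQ
  mem_T_iff t := by rw [LinearMap.BilinForm.mem_orthogonal_iff]
  mem_N_iff v := by
    obtain ⟨-, hint, -, -, h11, -⟩ := id hM
    rw [hNQ, qC_apply, qC_apply]
    constructor
    · intro hv
      have h := (h11 _).1 (isOfHodgeType_of_mem_algebraicClasses_of_isSmoothProjective hX 1 hv)
      rwa [LinearEquiv.apply_symm_apply] at h
    · intro hv
      have hrat : IsRationalClass (φ.symm fun i => (v i : ℂ)) :=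
        (isRationalClass_iff_of_markedSq hX hint _).2 ⟨v, φ.apply_symm_apply _⟩
      exact lefschetzOneOne_rational_holds hX _ hrat ((h11 _).2 (by rw [LinearEquiv.apply_symm_apply]; exact hv))
  period_mem := by
    have h := period_mem_span_ratTransc hX hM hNQ
    rwa [Set.image_eq_range] at h
  period_sq := by rw [qC_apply]; exact hM.2.2.2.2.2.1
  period_pos := by rw [qC_apply]; exact hM.2.2.2.2.2.2
  neg v hv h1 h2 hv0 := by
    rw [qC_apply] at h1 h2 ⊢
    exact re_bbf_self_star_neg hX hM hNQ hv h1 h2 hv0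

/-- The fields of the period datum, definitionally. [folklore] -/
theorem periodDatum_T (hX : IsSmoothProjective 4 X) (hM : MarkedK3Sq[X, φ, P, z])
    (hNQ : ∀ v, v ∈ NQ ↔ φ.symm (fun i => (v i : ℂ)) ∈ algebraicClasses X 1) :
    (periodDatum hX hM hNQ).T = (qQ).orthogonal NQ ∧ (periodDatum hX hM hNQ).N = NQ ∧
      (periodDatum hX hM hNQ).x = z ∧ (periodDatum hX hM hNQ).B = qQ ∧
      ∀ a b, (periodDatum hX hM hNQ).BC a b = k3HilbertForm 2 a b :=
  ⟨rfl, rfl, rfl, rfl, fun a b => qC_apply a b⟩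

/-! ### Reading rational Hodge endomorphisms of `H²(X)` in coordinates -/

/-- **A rational, type-preserving endomorphism of `H²(X(ℂ); ℂ)` in marking coordinates**: `φ ∘ G ∘ φ⁻¹` is
the complexification `cxEnd τ` of a rational endomorphism `τ` of `ℚ²³` (rational classes = `φ⁻¹(ℚ²³)`),
with the period `z` as an eigenvector (`G` preserves the line `H^{2,0} = ℂ φ⁻¹z`, (m4)) and preserving
`{z, z̄}^⊥` (`G` preserves type `(1,1)`, (m5)). The `X`-side analogue of `anchorExistence_cmFloor_exists_ratEnd`.
[cite: VoisinHodgeI2002, §7.1.1] [cite: Huybrechts2016K3, Ch. 3 §2.2] -/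
theorem exists_ratEnd_of_hodgeEndomorphism (hX : IsSmoothProjective 4 X) (hM : MarkedK3Sq[X, φ, P, z])
    (G : complexBetti X 2 →ₗ[ℂ] complexBetti X 2) (hG_rat : ∀ y, IsRationalClass y → IsRationalClass (G y))
    (hG_typ : ∀ (i j : ℕ) y, IsOfHodgeType 4 X 2 i j y → IsOfHodgeType 4 X 2 i j (G y)) :
    ∃ τ : Module.End ℚ (K3HilbertIndex → ℚ),
      cxEnd τ = φ.toLinearMap ∘ₗ G ∘ₗ φ.symm.toLinearMap ∧ (∃ c : ℂ, cxEnd τ z = c • z) ∧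
      ∀ w : K3HilbertIndex → ℂ, k3HilbertForm 2 w z = 0 → k3HilbertForm 2 w (star z) = 0 →
        k3HilbertForm 2 (cxEnd τ w) z = 0 ∧ k3HilbertForm 2 (cxEnd τ w) (star z) = 0 := by
  obtain ⟨-, hint, -, ⟨hz20, hz20'⟩, h11, -⟩ := id hM
  set M : Module.End ℂ (K3HilbertIndex → ℂ) := φ.toLinearMap ∘ₗ G ∘ₗ φ.symm.toLinearMap with hMdef
  have hMapp : ∀ w, M w = φ (G (φ.symm w)) := fun w => rfl
  have hrat : ∀ v : K3HilbertIndex → ℤ, ∃ w : K3HilbertIndex → ℚ, M (fun i => (v i : ℂ)) = fun i => (w i : ℂ) := by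
    intro v
    have hc : IsRationalClass (φ.symm fun i => (v i : ℂ)) :=
      ((hint _).2 ⟨v, φ.apply_symm_apply _⟩).isRationalClass
    obtain ⟨w, hw⟩ := (isRationalClass_iff_of_markedSq hX hint _).1 (hG_rat _ hc)
    exact ⟨w, by rw [hMapp, hw]⟩
  obtain ⟨τ, hτ⟩ := exists_ratEnd_of_forall_intCast' M hrat
  have hMτ : M = cxEnd τ := eq_cxEnd_of_forall hτ
  refine ⟨τ, hMτ.symm, ?_, ?_⟩
  · obtain ⟨t, ht⟩ := hz20' _ (hG_typ 2 0 _ hz20)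
    refine ⟨t, ?_⟩
    rw [← hMτ, hMapp, ht, map_smul, LinearEquiv.apply_symm_apply]
  · intro w hwz hwz'
    have hw11 : IsOfHodgeType 4 X 2 1 1 (φ.symm w) := (h11 _).2 (by rw [LinearEquiv.apply_symm_apply]; exact ⟨hwz, hwz'⟩)
    have h := (h11 _).1 (hG_typ 1 1 _ hw11)
    rw [← hMτ, hMapp]
    exact h

end Summit.HodgeConjecture.HodgeConjecture.Theorems.MarkmanPartnerTransport.PartnerLattice

end
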